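import Summits.NavierStokesRegularity.NavierStokesRegularity.Theorems.EfficiencyFloorNearSaturationNearMaximiserSeqCoreCompactness
import Summits.NavierStokesRegularity.NavierStokesRegularity.Theorems.EfficiencyFloorNearSaturationNearMaximiserDichotomy
import HarnessLib

/-!
# Route `EfficiencyFloor`, crux `NearSaturationNearMaximiser` (stmt-NavierStokesRegularity-25482) on the
# `ProductionEfficiencyDecay` ladder (stmt-22866): the WEAK → STRONG UPGRADE of the concentration-compactness step

Def-free helper file. After `…SeqCoreCompactness` (p840834) the open item stmt-25482 is, BY NAME, the statement
COMPACTNESS(`c⋆`): every sequence of admissible fields normalised to `Z = Pal = 1` whose stretching `S` tends to the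
sharp Lu–Doering constant `c⋆` has a subsequence of translates converging in `Ḣ¹ ∩ Ḣ²` to an admissible field. The
classical proof (Lions 1984) has three moves: (N) no vanishing — centre the sequence on a ball carrying a fixed fraction
of the enstrophy; (P) extract a weak profile `w` of the centred sequence and split `Z`, `Pal`, `S` asymptotically between
`w` and the remainder; (U) upgrade — sharpness of `c⋆` on both pieces and strict superadditivity of the envelope
`Z^{3/4}Pal^{3/4}` force the profile to carry everything, so the remainder tends to zero. This file PROVES (U)
((N) is proved in the companion file `…SeqCoreCentring`):

* §1 `upgrade_scalar`, `upgrade_tendsto`, `remainder_tendsto_zero` — the scalar core of (U): if `0 < α ≤ 1`, `0 ≤ β ≤ 1`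
  and `1 ≤ α^{3/4}β^{3/4} + (1−α)^{3/4}(1−β)^{3/4}` then `α = β = 1` (from the landed `Dichotomy.dichotomy_penalty`), and
  its sequential form for remainder functionals `Z(r_k) → 1 − Z(w)`, `Pal(r_k) → 1 − Pal(w)`, `S(r_k) → c − S(w)`
  dominated by the envelope with constant `c`: then `Z(w) = Pal(w) = 1` and `Z(r_k), Pal(r_k) → 0`.
* §2 `compact_of_weakProfile` — (U) in the tree's vocabulary: WEAK PROFILE at `c` (an admissible `w` with `0 < Z(w)`,
  translates `a_k`, a subsequence `φ`, asymptotic Pythagoras for `Z` and `Pal` — which is what weak convergence of the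
  translates to `w` in `Ḣ¹ ∩ Ḣ²` gives — and asymptotic splitting of `S` — the Brezis–Lieb step) ⟹ COMPACTNESS at `c`
  (the hypothesis `HC` of `seqCore_of_compact`, verbatim), for every positive admissible constant `c`.
* §3 `nearSaturationNearMaximiser_of_weakProfile` — BY NAME: WEAK PROFILE at the sharp constant ⟹
  `Theses.EfficiencyFloor.NearSaturationNearMaximiser` (stmt-25482).

HONEST FRAMING: the weak-profile hypothesis (profile extraction with splitting and an admissible limit — the regularity of
Lu–Doering extremisers included) is NOT proved here; stmt-25482, `LerayFloorGap`, `ProductionEfficiencyDecay` (stmt-22866)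
and Navier–Stokes regularity stay OPEN; no summit statement is proved. [folklore]
-/

-- the problem directory repeats the summit name (`NavierStokesRegularity/NavierStokesRegularity`)
set_option linter.dupNamespace false

noncomputable section

namespace Summit.NavierStokesRegularity.NavierStokesRegularity.Theorems

namespace NearSaturationNearMaximiser

namespace SeqCore

open Set MeasureTheory Filter Topology Function
open scoped InnerProductSpace ENNReal
open Literature.Analysis.FluidPDE
open Dichotomy

/-! ## §1 The scalar upgrade -/

/-- **Scalar upgrade.** For `0 < α ≤ 1`, `0 ≤ β ≤ 1`: `1 ≤ α^{3/4}β^{3/4} + (1−α)^{3/4}(1−β)^{3/4}` forces `α = β = 1`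
(if `0 < α < 1` the dichotomy penalty with `μ = min α (1−α)` bounds the sum by `(1−μ)^{1/4} < 1`; at `α = 1` the sum is
`β^{3/4}`). [folklore] -/
theorem upgrade_scalar {α β : ℝ} (hα0 : 0 < α) (hα1 : α ≤ 1) (hβ0 : 0 ≤ β) (hβ1 : β ≤ 1)
    (h : 1 ≤ α ^ (3 / 4 : ℝ) * β ^ (3 / 4 : ℝ) + (1 - α) ^ (3 / 4 : ℝ) * (1 - β) ^ (3 / 4 : ℝ)) :
    α = 1 ∧ β = 1 := by
  have hα : α = 1 := by
    by_contra hne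
    have hlt : α < 1 := lt_of_le_of_ne hα1 hne
    set μ : ℝ := min α (1 - α) with hμ
    have hμ0 : 0 < μ := lt_min hα0 (by linarith)
    have hμα : μ ≤ α := min_le_left _ _
    have hμα' : μ ≤ 1 - α := min_le_right _ _
    have hsumα : α + (1 - α) = 1 := by ring
    have hsumβ : β + (1 - β) = 1 := by ring
    have h₁ : α ≤ (1 - μ) * (α + (1 - α)) := by rw [hsumα, mul_one]; linarith
    have h₂ : 1 - α ≤ (1 - μ) * (α + (1 - α)) := by rw [hsumα, mul_one]; linarith
    have hpen := dichotomy_penalty (P₁ := β) (P₂ := 1 - β) hα0.le (by linarith) hβ0 (by linarith) h₁ h₂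
    rw [hsumα, hsumβ, Real.one_rpow, one_mul] at hpen
    have hlt1 : (1 - μ) ^ (1 / 4 : ℝ) < 1 := Real.rpow_lt_one (by linarith) (by linarith) (by norm_num)
    linarith
  refine ⟨hα, ?_⟩
  rw [hα, sub_self, Real.one_rpow, one_mul, Real.zero_rpow (by norm_num), zero_mul, add_zero] at h
  by_contra hne
  have hlt : β < 1 := lt_of_le_of_ne hβ1 hne
  have hlt1 : β ^ (3 / 4 : ℝ) < 1 := Real.rpow_lt_one hβ0 hlt (by norm_num)
  linarith

/-- **Sequential upgrade.** Numbers of a weak profile `w` (`0 < Z_w`, `0 ≤ P_w`, `S_w ≤ c Z_w^{3/4} P_w^{3/4}`) and of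
remainders `r_k` (`Z_k, P_k ≥ 0`, `S_k ≤ c Z_k^{3/4} P_k^{3/4}`) with `Z_k → 1 − Z_w`, `P_k → 1 − P_w`, `S_k → c − S_w`
(`c > 0`): then `Z_w = P_w = 1` — the profile carries all the enstrophy and all the palinstrophy. [folklore] -/
theorem upgrade_tendsto {c Zw Pw Sw : ℝ} {Zr Pr Sr : ℕ → ℝ} (hc : 0 < c) (hZw : 0 < Zw) (hPw : 0 ≤ Pw)
    (hSw : Sw ≤ c * Zw ^ (3 / 4 : ℝ) * Pw ^ (3 / 4 : ℝ))
    (hZr : ∀ k, 0 ≤ Zr k) (hPr : ∀ k, 0 ≤ Pr k) (hSr : ∀ k, Sr k ≤ c * Zr k ^ (3 / 4 : ℝ) * Pr k ^ (3 / 4 : ℝ))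
    (hZlim : Tendsto Zr atTop (𝓝 (1 - Zw))) (hPlim : Tendsto Pr atTop (𝓝 (1 - Pw)))
    (hSlim : Tendsto Sr atTop (𝓝 (c - Sw))) :
    Zw = 1 ∧ Pw = 1 := by
  have hZw1 : Zw ≤ 1 := by
    have h0 : (0 : ℝ) ≤ 1 - Zw := ge_of_tendsto' hZlim hZr
    linarith
  have hPw1 : Pw ≤ 1 := by
    have h0 : (0 : ℝ) ≤ 1 - Pw := ge_of_tendsto' hPlim hPr
    linarith
  have henv : Tendsto (fun k => c * Zr k ^ (3 / 4 : ℝ) * Pr k ^ (3 / 4 : ℝ)) atTop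
      (𝓝 (c * (1 - Zw) ^ (3 / 4 : ℝ) * (1 - Pw) ^ (3 / 4 : ℝ))) :=
    ((hZlim.rpow_const (Or.inr (by norm_num))).const_mul c).mul (hPlim.rpow_const (Or.inr (by norm_num)))
  have hle : c - Sw ≤ c * (1 - Zw) ^ (3 / 4 : ℝ) * (1 - Pw) ^ (3 / 4 : ℝ) :=
    le_of_tendsto_of_tendsto' hSlim henv hSr
  have h1 : 1 ≤ Zw ^ (3 / 4 : ℝ) * Pw ^ (3 / 4 : ℝ) + (1 - Zw) ^ (3 / 4 : ℝ) * (1 - Pw) ^ (3 / 4 : ℝ) := by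
    have hcc : c * 1 ≤ c * (Zw ^ (3 / 4 : ℝ) * Pw ^ (3 / 4 : ℝ) + (1 - Zw) ^ (3 / 4 : ℝ) * (1 - Pw) ^ (3 / 4 : ℝ)) := by
      nlinarith
    exact le_of_mul_le_mul_left hcc hc
  exact upgrade_scalar hZw hZw1 hPw hPw1 h1

/-- The remainders of a weak profile tend to zero in `Ḣ¹ ∩ Ḣ²` (`Z_k → 0`, `P_k → 0`). [folklore] -/
theorem remainder_tendsto_zero {c Zw Pw Sw : ℝ} {Zr Pr Sr : ℕ → ℝ} (hc : 0 < c) (hZw : 0 < Zw) (hPw : 0 ≤ Pw)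
    (hSw : Sw ≤ c * Zw ^ (3 / 4 : ℝ) * Pw ^ (3 / 4 : ℝ))
    (hZr : ∀ k, 0 ≤ Zr k) (hPr : ∀ k, 0 ≤ Pr k) (hSr : ∀ k, Sr k ≤ c * Zr k ^ (3 / 4 : ℝ) * Pr k ^ (3 / 4 : ℝ))
    (hZlim : Tendsto Zr atTop (𝓝 (1 - Zw))) (hPlim : Tendsto Pr atTop (𝓝 (1 - Pw)))
    (hSlim : Tendsto Sr atTop (𝓝 (c - Sw))) :
    Tendsto Zr atTop (𝓝 0) ∧ Tendsto Pr atTop (𝓝 0) := by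
  obtain ⟨hZ1, hP1⟩ := upgrade_tendsto hc hZw hPw hSw hZr hPr hSr hZlim hPlim hSlim
  rw [hZ1, sub_self] at hZlim
  rw [hP1, sub_self] at hPlim
  exact ⟨hZlim, hPlim⟩

/-! ## §2 Weak profile ⟹ compactness (the upgrade in the tree's vocabulary) -/

/-- **WEAK PROFILE ⟹ COMPACTNESS.** Let `c > 0` be an admissible one-sided Lu–Doering constant (`S ≤ c Z^{3/4} Pal^{3/4}`
on admissible fields). Suppose every admissible sequence `v_n` with `Z = Pal = 1`, `S(v_n) → c` has a WEAK PROFILE: an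
admissible `w` with `0 < Z(w)`, translates `a_k` and a subsequence `φ` such that the remainders
`r_k = v_{φ k}(· − a_k) − w` satisfy `Z(r_k) → 1 − Z(w)`, `Pal(r_k) → 1 − Pal(w)` (asymptotic Pythagoras = weak convergence
in `Ḣ¹ ∩ Ḣ²`) and `S(r_k) → c − S(w)` (splitting of the stretching). Then the sequence is precompact modulo
translations in the sense of `seqCore_of_compact`: `Z(r_k) → 0` and `Pal(r_k) → 0`. [folklore] -/
theorem compact_of_weakProfile {c : ℝ} (hc : 0 < c)
    (hadm : ∀ f : EuclideanSpace ℝ (Fin 3) → EuclideanSpace ℝ (Fin 3), (ContDiff ℝ (⊤ : ℕ∞) f ∧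
      Literature.Analysis.FluidPDE.VectorCalculus.IsDivFree f ∧ (∫⁻ x, ‖iteratedFDeriv ℝ 0 f x‖ₑ ^ 2 < ⊤) ∧
      (∫⁻ x, ‖iteratedFDeriv ℝ 1 f x‖ₑ ^ 2 < ⊤) ∧ (∫⁻ x, ‖iteratedFDeriv ℝ 2 f x‖ₑ ^ 2 < ⊤)) → (∫ x,
      ⟪Literature.Analysis.FluidPDE.curl f x, fderiv ℝ f x (Literature.Analysis.FluidPDE.curl f x)⟫_ℝ) ≤ c *
      (∫ x, ‖Literature.Analysis.FluidPDE.curl f x‖ ^ 2) ^ (3 / 4 : ℝ) * (∫ x,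
      Literature.Analysis.FluidPDE.frobeniusNormSq (fderiv ℝ (Literature.Analysis.FluidPDE.curl f) x)) ^ (3 / 4 : ℝ))
    (HW : ∀ v : ℕ → EuclideanSpace ℝ (Fin 3) → EuclideanSpace ℝ (Fin 3), (∀ n, ContDiff ℝ (⊤ : ℕ∞) (v n) ∧
      Literature.Analysis.FluidPDE.VectorCalculus.IsDivFree (v n) ∧ (∫⁻ x, ‖iteratedFDeriv ℝ 0 (v n) x‖ₑ ^ 2 < ⊤) ∧
      (∫⁻ x, ‖iteratedFDeriv ℝ 1 (v n) x‖ₑ ^ 2 < ⊤) ∧ (∫⁻ x, ‖iteratedFDeriv ℝ 2 (v n) x‖ₑ ^ 2 < ⊤)) →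
      (∀ n, (∫ x, ‖Literature.Analysis.FluidPDE.curl (v n) x‖ ^ 2) = 1) →
      (∀ n, (∫ x, Literature.Analysis.FluidPDE.frobeniusNormSq (fderiv ℝ (Literature.Analysis.FluidPDE.curl (v n)) x)) = 1) →
      Tendsto (fun n => ∫ x, ⟪Literature.Analysis.FluidPDE.curl (v n) x, fderiv ℝ (v n) x
        (Literature.Analysis.FluidPDE.curl (v n) x)⟫_ℝ) atTop (𝓝 c) →
      ∃ w : EuclideanSpace ℝ (Fin 3) → EuclideanSpace ℝ (Fin 3), (ContDiff ℝ (⊤ : ℕ∞) w ∧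
        Literature.Analysis.FluidPDE.VectorCalculus.IsDivFree w ∧ (∫⁻ x, ‖iteratedFDeriv ℝ 0 w x‖ₑ ^ 2 < ⊤) ∧
        (∫⁻ x, ‖iteratedFDeriv ℝ 1 w x‖ₑ ^ 2 < ⊤) ∧ (∫⁻ x, ‖iteratedFDeriv ℝ 2 w x‖ₑ ^ 2 < ⊤)) ∧
        0 < (∫ x, ‖Literature.Analysis.FluidPDE.curl w x‖ ^ 2) ∧
        ∃ (a : ℕ → EuclideanSpace ℝ (Fin 3)) (φ : ℕ → ℕ), StrictMono φ ∧
        Tendsto (fun k => ∫ x, ‖Literature.Analysis.FluidPDE.curl ((fun x => v (φ k) (x - a k)) - w) x‖ ^ 2) atTop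
          (𝓝 (1 - ∫ x, ‖Literature.Analysis.FluidPDE.curl w x‖ ^ 2)) ∧
        Tendsto (fun k => ∫ x, Literature.Analysis.FluidPDE.frobeniusNormSq (fderiv ℝ
          (Literature.Analysis.FluidPDE.curl ((fun x => v (φ k) (x - a k)) - w)) x)) atTop
          (𝓝 (1 - ∫ x, Literature.Analysis.FluidPDE.frobeniusNormSq (fderiv ℝ (Literature.Analysis.FluidPDE.curl w) x))) ∧
        Tendsto (fun k => ∫ x, ⟪Literature.Analysis.FluidPDE.curl ((fun x => v (φ k) (x - a k)) - w) x,
          fderiv ℝ ((fun x => v (φ k) (x - a k)) - w) x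
          (Literature.Analysis.FluidPDE.curl ((fun x => v (φ k) (x - a k)) - w) x)⟫_ℝ) atTop
          (𝓝 (c - ∫ x, ⟪Literature.Analysis.FluidPDE.curl w x, fderiv ℝ w x (Literature.Analysis.FluidPDE.curl w x)⟫_ℝ))) :
    ∀ v : ℕ → EuclideanSpace ℝ (Fin 3) → EuclideanSpace ℝ (Fin 3), (∀ n, ContDiff ℝ (⊤ : ℕ∞) (v n) ∧
      Literature.Analysis.FluidPDE.VectorCalculus.IsDivFree (v n) ∧ (∫⁻ x, ‖iteratedFDeriv ℝ 0 (v n) x‖ₑ ^ 2 < ⊤) ∧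
      (∫⁻ x, ‖iteratedFDeriv ℝ 1 (v n) x‖ₑ ^ 2 < ⊤) ∧ (∫⁻ x, ‖iteratedFDeriv ℝ 2 (v n) x‖ₑ ^ 2 < ⊤)) →
      (∀ n, (∫ x, ‖Literature.Analysis.FluidPDE.curl (v n) x‖ ^ 2) = 1) →
      (∀ n, (∫ x, Literature.Analysis.FluidPDE.frobeniusNormSq (fderiv ℝ (Literature.Analysis.FluidPDE.curl (v n)) x)) = 1) →
      Tendsto (fun n => ∫ x, ⟪Literature.Analysis.FluidPDE.curl (v n) x, fderiv ℝ (v n) x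
        (Literature.Analysis.FluidPDE.curl (v n) x)⟫_ℝ) atTop (𝓝 c) →
      ∃ w : EuclideanSpace ℝ (Fin 3) → EuclideanSpace ℝ (Fin 3), (ContDiff ℝ (⊤ : ℕ∞) w ∧
        Literature.Analysis.FluidPDE.VectorCalculus.IsDivFree w ∧ (∫⁻ x, ‖iteratedFDeriv ℝ 0 w x‖ₑ ^ 2 < ⊤) ∧
        (∫⁻ x, ‖iteratedFDeriv ℝ 1 w x‖ₑ ^ 2 < ⊤) ∧ (∫⁻ x, ‖iteratedFDeriv ℝ 2 w x‖ₑ ^ 2 < ⊤)) ∧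
        ∃ (a : ℕ → EuclideanSpace ℝ (Fin 3)) (φ : ℕ → ℕ), StrictMono φ ∧
        Tendsto (fun k => ∫ x, ‖Literature.Analysis.FluidPDE.curl ((fun x => v (φ k) (x - a k)) - w) x‖ ^ 2) atTop (𝓝 0) ∧
        Tendsto (fun k => ∫ x, Literature.Analysis.FluidPDE.frobeniusNormSq (fderiv ℝ
          (Literature.Analysis.FluidPDE.curl ((fun x => v (φ k) (x - a k)) - w)) x)) atTop (𝓝 0) := by
  intro v hAdm hZ1 hP1 hS
  obtain ⟨w, hw, hZw0, a, φ, hφ, hZ, hP, hSspl⟩ := HW v hAdm hZ1 hP1 hS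
  -- the remainders are admissible, hence dominated by the envelope with constant `c`
  have hrAdm : ∀ k, ContDiff ℝ (⊤ : ℕ∞) ((fun x => v (φ k) (x - a k)) - w) ∧
      VectorCalculus.IsDivFree ((fun x => v (φ k) (x - a k)) - w) ∧
      (∫⁻ x, ‖iteratedFDeriv ℝ 0 ((fun x => v (φ k) (x - a k)) - w) x‖ₑ ^ 2 < ⊤) ∧
      (∫⁻ x, ‖iteratedFDeriv ℝ 1 ((fun x => v (φ k) (x - a k)) - w) x‖ₑ ^ 2 < ⊤) ∧
      (∫⁻ x, ‖iteratedFDeriv ℝ 2 ((fun x => v (φ k) (x - a k)) - w) x‖ₑ ^ 2 < ⊤) := fun k =>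
    admissible_sub (admissible_translate (hAdm (φ k)) (a k)) hw
  have hlim := remainder_tendsto_zero (Zw := ∫ x, ‖curl w x‖ ^ 2)
    (Pw := ∫ x, frobeniusNormSq (fderiv ℝ (curl w) x))
    (Sw := ∫ x, ⟪curl w x, fderiv ℝ w x (curl w x)⟫_ℝ)
    (Zr := fun k => ∫ x, ‖curl ((fun x => v (φ k) (x - a k)) - w) x‖ ^ 2)
    (Pr := fun k => ∫ x, frobeniusNormSq (fderiv ℝ (curl ((fun x => v (φ k) (x - a k)) - w)) x))
    (Sr := fun k => ∫ x, ⟪curl ((fun x => v (φ k) (x - a k)) - w) x, fderiv ℝ ((fun x => v (φ k) (x - a k)) - w) x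
      (curl ((fun x => v (φ k) (x - a k)) - w) x)⟫_ℝ)
    hc hZw0 (integral_nonneg fun x => frobeniusNormSq_nonneg _) (hadm w hw)
    (fun k => integral_nonneg fun x => by positivity) (fun k => integral_nonneg fun x => frobeniusNormSq_nonneg _)
    (fun k => hadm _ (hrAdm k)) hZ hP hSspl
  exact ⟨w, hw, a, φ, hφ, hlim.1, hlim.2⟩

/-! ## §3 By name -/

/-- **`NearSaturationNearMaximiser` (stmt-25482) from a WEAK PROFILE, BY NAME.** If for the sharp one-sided Lu–Doering
constant `c⋆` (the item's sharp-constant clause, verbatim) every admissible sequence with `Z = Pal = 1`, `S → c⋆` has a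
weak profile in the sense of `compact_of_weakProfile` (nonzero admissible profile modulo translations, asymptotic
Pythagoras for `Z`, `Pal`, splitting of `S`), then the route decl holds (`compact_of_weakProfile` +
`nearSaturationNearMaximiser_of_compact`, p840834). The hypothesis is the open profile-extraction/regularity step of the
Lu–Doering extremal problem; it is NOT proved here. [folklore] -/
theorem nearSaturationNearMaximiser_of_weakProfile
    (HW : ∀ c : ℝ, (0 < c ∧ (∀ v : EuclideanSpace ℝ (Fin 3) → EuclideanSpace ℝ (Fin 3), (ContDiff ℝ (⊤ : ℕ∞) v ∧
      Literature.Analysis.FluidPDE.VectorCalculus.IsDivFree v ∧ (∫⁻ x, ‖iteratedFDeriv ℝ 0 v x‖ₑ ^ 2 < ⊤) ∧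
      (∫⁻ x, ‖iteratedFDeriv ℝ 1 v x‖ₑ ^ 2 < ⊤) ∧ (∫⁻ x, ‖iteratedFDeriv ℝ 2 v x‖ₑ ^ 2 < ⊤)) → (∫ x,
      ⟪Literature.Analysis.FluidPDE.curl v x, fderiv ℝ v x (Literature.Analysis.FluidPDE.curl v x)⟫_ℝ) ≤ c *
      (∫ x, ‖Literature.Analysis.FluidPDE.curl v x‖ ^ 2) ^ (3 / 4 : ℝ) * (∫ x,
      Literature.Analysis.FluidPDE.frobeniusNormSq (fderiv ℝ (Literature.Analysis.FluidPDE.curl v) x)) ^ (3 /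
      4 : ℝ)) ∧ ∀ c' : ℝ, (∀ w : EuclideanSpace ℝ (Fin 3) → EuclideanSpace ℝ (Fin 3), (ContDiff ℝ (⊤ : ℕ∞) w ∧
      Literature.Analysis.FluidPDE.VectorCalculus.IsDivFree w ∧ (∫⁻ x, ‖iteratedFDeriv ℝ 0 w x‖ₑ ^ 2 < ⊤) ∧
      (∫⁻ x, ‖iteratedFDeriv ℝ 1 w x‖ₑ ^ 2 < ⊤) ∧ (∫⁻ x, ‖iteratedFDeriv ℝ 2 w x‖ₑ ^ 2 < ⊤)) → (∫ x,
      ⟪Literature.Analysis.FluidPDE.curl w x, fderiv ℝ w x (Literature.Analysis.FluidPDE.curl w x)⟫_ℝ) ≤ c' *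
      (∫ x, ‖Literature.Analysis.FluidPDE.curl w x‖ ^ 2) ^ (3 / 4 : ℝ) * (∫ x,
      Literature.Analysis.FluidPDE.frobeniusNormSq (fderiv ℝ (Literature.Analysis.FluidPDE.curl w) x)) ^ (3 /
      4 : ℝ)) → c ≤ c') →
      ∀ v : ℕ → EuclideanSpace ℝ (Fin 3) → EuclideanSpace ℝ (Fin 3), (∀ n, ContDiff ℝ (⊤ : ℕ∞) (v n) ∧
      Literature.Analysis.FluidPDE.VectorCalculus.IsDivFree (v n) ∧ (∫⁻ x, ‖iteratedFDeriv ℝ 0 (v n) x‖ₑ ^ 2 < ⊤) ∧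
      (∫⁻ x, ‖iteratedFDeriv ℝ 1 (v n) x‖ₑ ^ 2 < ⊤) ∧ (∫⁻ x, ‖iteratedFDeriv ℝ 2 (v n) x‖ₑ ^ 2 < ⊤)) →
      (∀ n, (∫ x, ‖Literature.Analysis.FluidPDE.curl (v n) x‖ ^ 2) = 1) →
      (∀ n, (∫ x, Literature.Analysis.FluidPDE.frobeniusNormSq (fderiv ℝ (Literature.Analysis.FluidPDE.curl (v n)) x)) = 1) →
      Tendsto (fun n => ∫ x, ⟪Literature.Analysis.FluidPDE.curl (v n) x, fderiv ℝ (v n) x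
        (Literature.Analysis.FluidPDE.curl (v n) x)⟫_ℝ) atTop (𝓝 c) →
      ∃ w : EuclideanSpace ℝ (Fin 3) → EuclideanSpace ℝ (Fin 3), (ContDiff ℝ (⊤ : ℕ∞) w ∧
        Literature.Analysis.FluidPDE.VectorCalculus.IsDivFree w ∧ (∫⁻ x, ‖iteratedFDeriv ℝ 0 w x‖ₑ ^ 2 < ⊤) ∧
        (∫⁻ x, ‖iteratedFDeriv ℝ 1 w x‖ₑ ^ 2 < ⊤) ∧ (∫⁻ x, ‖iteratedFDeriv ℝ 2 w x‖ₑ ^ 2 < ⊤)) ∧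
        0 < (∫ x, ‖Literature.Analysis.FluidPDE.curl w x‖ ^ 2) ∧
        ∃ (a : ℕ → EuclideanSpace ℝ (Fin 3)) (φ : ℕ → ℕ), StrictMono φ ∧
        Tendsto (fun k => ∫ x, ‖Literature.Analysis.FluidPDE.curl ((fun x => v (φ k) (x - a k)) - w) x‖ ^ 2) atTop
          (𝓝 (1 - ∫ x, ‖Literature.Analysis.FluidPDE.curl w x‖ ^ 2)) ∧
        Tendsto (fun k => ∫ x, Literature.Analysis.FluidPDE.frobeniusNormSq (fderiv ℝ
          (Literature.Analysis.FluidPDE.curl ((fun x => v (φ k) (x - a k)) - w)) x)) atTop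
          (𝓝 (1 - ∫ x, Literature.Analysis.FluidPDE.frobeniusNormSq (fderiv ℝ (Literature.Analysis.FluidPDE.curl w) x))) ∧
        Tendsto (fun k => ∫ x, ⟪Literature.Analysis.FluidPDE.curl ((fun x => v (φ k) (x - a k)) - w) x,
          fderiv ℝ ((fun x => v (φ k) (x - a k)) - w) x
          (Literature.Analysis.FluidPDE.curl ((fun x => v (φ k) (x - a k)) - w) x)⟫_ℝ) atTop
          (𝓝 (c - ∫ x, ⟪Literature.Analysis.FluidPDE.curl w x, fderiv ℝ w x (Literature.Analysis.FluidPDE.curl w x)⟫_ℝ))) :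
    Summit.NavierStokesRegularity.NavierStokesRegularity.Theses.EfficiencyFloor.NearSaturationNearMaximiser :=
  nearSaturationNearMaximiser_of_compact fun c hsharp =>
    compact_of_weakProfile hsharp.1 (fun f hf => hsharp.2.1 f hf) (HW c hsharp)

end SeqCore

end NearSaturationNearMaximiser

end Summit.NavierStokesRegularity.NavierStokesRegularity.Theorems

end
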